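import Literature.IUT.HodgeTheaters.LocalFrobenioidsWitness
import HarnessLib

/-!
# [IUTchI] Example 3.3: the five "may be reconstructed category-theoretically" clauses are jointly
# CONSISTENT with the interface `GoodLocalFrobenioid` (kernel witness)

Mochizuki, *Inter-universal Teichmüller theory I*, §3, Example 3.3 (iii) (a)–(e), kurims May-2020
manuscript pp. 77–79 [claim: Mochizuki2012, status: disputed]. abc-iut cell, WAVE-4 (D-0067) cone-interior
seat abc-iut-w4-d047; DAG nodes `IUTchI:Ex3.3(i)`–`(iii)`; sibling of `BadLocalFrobenioidClaimsWitness.lean`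
(Example 3.2).

`SplitFrobenioids.lean` (abc-iut-L5-t2) types the reconstruction sentences of Example 3.3 (iii) as five
MODEL-RELATIVE `Prop`s on the interface `GoodLocalFrobenioid p K_v`: `DdashFromD` (a), `BasesFromC` (b),
`DFromF` (c), `CdashFromF` (d), `SplitFromF` (e). As for Example 3.2 they are properties the REAL
construction (the `p_v`-adic Frobenioids of [FrdII] Ex. 1.1 over `B(X̲→_v)⁰`; merge in progress on
abc-iut-L5-t2's `GoodLocalFrobenioid.ofKit`) is claimed to have, not consequences of the interface fields
(the counter-model `BadLocalFrobenioid.doubling` of `BadLocalFrobenioidClaimsIndependence.lean` adapts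
verbatim to `DdashFromD`/`CdashFromF` here). THIS FILE proves that all five hold on abc-iut-L5-t2's landed
inhabitant `GoodLocalFrobenioid.trivial p` over `K_v := ℚ_p` (`LocalFrobenioidsWitness.lean`), for every
prime `p`, and records the conjunction: the interface TOGETHER WITH the five clauses is consistent, so no
downstream statement hypothesising them is vacuous. Nothing here asserts anything about the objects of the
text; typed ≠ proved; no side is taken on [IUTchIII] Cor. 3.12.
-/

namespace Literature.IUT.HodgeTheaters

open CategoryTheory

namespace Witness

/-- Any two functors `Pt ⥤ Pt` are isomorphic (local copy). [folklore] -/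
private theorem nonempty_iso_pt_pt' (F G : Pt ⥤ Pt) : Nonempty (F ≅ G) := ⟨isoOfPt F G⟩

/-- The empty splitting `⊥` on `Pt` is preserved by every endofunctor of `Pt` (local copy). [folklore] -/
private theorem botSplitting_pt_isPreservedBy' (Φ : Pt ⥤ Pt) :
    (botSplitting Pt).IsPreservedBy (botSplitting Pt) Φ :=
  fun _ => Submonoid.map_bot _

end Witness

open Witness

namespace GoodLocalFrobenioid

variable (p : ℕ) [Fact p.Prime]

/-- Ex. 3.3 (iii) (a) `DdashFromD` ("`D⊢_v ⊆ D_v` may be reconstructed category-theoretically from `D_v`",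
[AbsAnab] Lem. 1.3.8) holds on the trivial inhabitant. [claim: Mochizuki2012, status: disputed] -/
theorem trivial_ddashFromD : (GoodLocalFrobenioid.trivial p).DdashFromD :=
  fun _ => ⟨CategoryTheory.Equivalence.refl, nonempty_iso_pt_pt' _ _⟩

/-- Ex. 3.3 (iii) (b) `BasesFromC` ("`D⊢_v` (resp. `D^Θ_v`) may be reconstructed category-theoretically
from `C⊢_v` (resp. `C^Θ_v`)") holds on the trivial inhabitant. [claim: Mochizuki2012, status: disputed] -/
theorem trivial_basesFromC : (GoodLocalFrobenioid.trivial p).BasesFromC :=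
  ⟨fun _ => ⟨CategoryTheory.Equivalence.refl, nonempty_iso_pt_pt' _ _⟩,
    fun _ => ⟨CategoryTheory.Equivalence.refl, nonempty_iso_pt_pt' _ _⟩⟩

/-- Ex. 3.3 (iii) (c) `DFromF` ("`D_v` may be reconstructed category-theoretically from `F̲_v = C_v`")
holds on the trivial inhabitant. [claim: Mochizuki2012, status: disputed] -/
theorem trivial_dFromF : (GoodLocalFrobenioid.trivial p).DFromF :=
  fun _ => ⟨CategoryTheory.Equivalence.refl, nonempty_iso_pt_pt' _ _⟩

/-- Ex. 3.3 (iii) (d) `CdashFromF` ("`C⊢_v` may be reconstructed category-theoretically from `F̲_v`",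
[FrdI] Cor. 4.11 (iii)) holds on the trivial inhabitant. [claim: Mochizuki2012, status: disputed] -/
theorem trivial_cdashFromF : (GoodLocalFrobenioid.trivial p).CdashFromF :=
  fun _ => ⟨CategoryTheory.Equivalence.refl, nonempty_iso_pt_pt' _ _⟩

/-- Ex. 3.3 (iii) (e) `SplitFromF` ("one may reconstruct the split Frobenioids `F⊢_v`, `F^Θ_v`
category-theoretically from `F̲_v`", via the Kummer map of [AbsTopIII] Prop. 3.2 (iii)) holds on the
trivial inhabitant (the splittings `⊥` are preserved by the identity lifts). [claim: Mochizuki2012, status: disputed] -/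
theorem trivial_splitFromF : (GoodLocalFrobenioid.trivial p).SplitFromF :=
  fun _ => ⟨CategoryTheory.Equivalence.refl, CategoryTheory.Equivalence.refl, nonempty_iso_pt_pt' _ _,
    botSplitting_pt_isPreservedBy' _, nonempty_iso_pt_pt' _ _, botSplitting_pt_isPreservedBy' _⟩

/-- **Joint consistency of the Example 3.3 (iii) reconstruction clauses with the interface**: on
abc-iut-L5-t2's inhabitant `GoodLocalFrobenioid.trivial p` (over `K_v := ℚ_p`) ALL FIVE typed clauses
(a) `DdashFromD`, (b) `BasesFromC`, (c) `DFromF`, (d) `CdashFromF`, (e) `SplitFromF` hold simultaneously.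
(Kernel certificate for DAG nodes `IUTchI:Ex3.3(i)`–`(iii)`; the clauses themselves remain properties to
be proved of the real construction at merge.) [claim: Mochizuki2012, status: disputed] -/
theorem trivial_ex33Claims :
    (GoodLocalFrobenioid.trivial p).DdashFromD ∧ (GoodLocalFrobenioid.trivial p).BasesFromC ∧
    (GoodLocalFrobenioid.trivial p).DFromF ∧ (GoodLocalFrobenioid.trivial p).CdashFromF ∧
    (GoodLocalFrobenioid.trivial p).SplitFromF :=
  ⟨trivial_ddashFromD p, trivial_basesFromC p, trivial_dFromF p, trivial_cdashFromF p,
    trivial_splitFromF p⟩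

/-- Hence, for every prime `p`, the interface `GoodLocalFrobenioid p ℚ_p` TOGETHER WITH all five Example
3.3 (iii) reconstruction clauses is inhabited. [claim: Mochizuki2012, status: disputed] -/
theorem exists_ex33Claims :
    ∃ G : GoodLocalFrobenioid.{0} p ℚ_[p],
      G.DdashFromD ∧ G.BasesFromC ∧ G.DFromF ∧ G.CdashFromF ∧ G.SplitFromF :=
  ⟨GoodLocalFrobenioid.trivial p, trivial_ex33Claims p⟩

end GoodLocalFrobenioid

end Literature.IUT.HodgeTheaters
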